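/-
Copyright (c) 2026. All rights reserved.
Released under Apache 2.0 license as described in the file LICENSE.
Authors: abc-iut cell — seat abc-iut-w5-d226 (wave 5), over abc-iut-L4-t14's §4 files.
-/
import Literature.AnabelianGeometry.AbsoluteAnabelian.ArchimedeanLogFrobeniusFunctors
import HarnessLib

/-!
# [AbsTopIII] Prop 4.2 (ii), object level: a `TF`-pair is canonically isomorphic to the `LinHol` pair of
# its structure-orbispace — PROOF (sub-DAG `plan/L4/SUBDAG-AbsTopIII-Prop42.md`, row P42.ii/L13)

S. Mochizuki, *Topics in absolute anabelian geometry III*, Prop 4.2 (ii) pp.105–106: "The equivalence of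
categories `κ_LH : EA ⥲ LinHol` of Definition 4.1, (v) — i.e., the functorial algorithms of Corollary 2.7 —
determines a natural [1-]factorization `𝒞^hol_TF → 𝒞^hol_TM →^{𝔩𝔬𝔤_{TM,T}} 𝒞^hol_T` … of the log-Frobenius
functors `𝔩𝔬𝔤_{TF,T}`."  Its object-level content over the landed vocabulary (abc-iut-L4-t14:
`ModelAutHolPair.toPair`, `AutHolPair.Iso` in `ArchimedeanLogFrobenius.lean`; `linHolPair`,
`ModelAutHolPair.ofType` in `ArchimedeanLogFrobeniusFunctors.lean`): the `TF`-pair `(𝕏 ↶ k)` underlying a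
model is ISOMORPHIC to the `LinHol` pair `(𝕏, 𝒜_𝕏 ↶ 𝒜_𝕏)` (Def 4.1 (v): "the tautological Kummer map") by
the isomorphism whose structure part and `𝒜`-part are identities and whose arithmetic part is the Kummer
structure `κ_k : k ⥲ 𝒜_𝕏` itself — so the `TF`-pair is recovered, up to this canonical isomorphism, from
its structure-orbispace with `𝒜_𝕏` (the output of Cor 2.7), hence from its image under any of the natural
functors `𝒞^hol_TF → 𝒞^hol_T'` (which keep `(𝕏, 𝒜_𝕏)`: `ModelAutHolPair.ofType`).  Proof-only (kind=proof;
no new notions); bib key `MochizukiAbsTopIII2015`.  Refereed pre-IUT material; nothing here bears on the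
disputed [IUTchIII] Cor. 3.12.
-/

namespace Literature.AnabelianGeometry.AbsoluteAnabelian

open _root_.TopologicalSpace _root_.Topology

universe u

noncomputable section

/-- The arithmetic data of a model `TF`-pair is all of `k` (closed under multiplication).
[cite: MochizukiAbsTopIII2015, Definition 4.1 (i) p.102] -/
theorem ModelAutHolPair.mul_mem_arithData_TF (P : ModelAutHolPair.{u} .TF) (x y : P.k)
    (_hx : x ∈ P.arithData) (_hy : y ∈ P.arithData) : x * y ∈ P.arithData := by
  simp [ModelAutHolPair.arithData]

/-- The arithmetic data of a model `TF`-pair contains `1`. [cite: MochizukiAbsTopIII2015, Definition 4.1 (i) p.102] -/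
theorem ModelAutHolPair.one_mem_arithData_TF (P : ModelAutHolPair.{u} .TF) : (1 : P.k) ∈ P.arithData := by
  simp [ModelAutHolPair.arithData]

/-- **Prop 4.2 (ii), object level (sub-DAG row P42.ii/L13)**: the `TF`-pair `(𝕏 ↶ k)` underlying a model
Aut-holomorphic `TF`-pair is isomorphic to the `LinHol` pair `(𝕏, 𝒜_𝕏 ↶ 𝒜_𝕏)` of its structure-orbispace by
an isomorphism with structure part `id`, `𝒜`-part `id` and arithmetic part the Kummer structure `κ_k`.
[cite: MochizukiAbsTopIII2015, Proposition 4.2 (ii) pp.105–106] -/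
theorem ModelAutHolPair.exists_iso_linHolPair (P : ModelAutHolPair.{u} .TF) :
    ∃ e : (P.toPair P.mul_mem_arithData_TF P.one_mem_arithData_TF).Iso (linHolPair P.X P.L P.A),
      e.isoU = Homeomorph.refl P.U ∧ e.isoA = RingEquiv.refl P.A.F ∧
        ∀ m : (P.toPair P.mul_mem_arithData_TF P.one_mem_arithData_TF).M, (e.isoM m : P.A.F) = P.κ.κ m.1 := by
  refine ⟨{ isoU := Homeomorph.refl P.U
            isoU_isMorphism := ⟨P.X.str.isMorphism_id, P.X.str.isMorphism_id⟩
            isoA := RingEquiv.refl P.A.F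
            isoM :=
              { toFun := fun m => P.κ.κ m.1
                invFun := fun a => ⟨P.κ.κ.symm a, by simp [ModelAutHolPair.arithData]⟩
                left_inv := fun m => Subtype.ext (P.κ.κ.symm_apply_apply m.1)
                right_inv := fun a => P.κ.κ.apply_symm_apply a
                map_mul' := fun m m' => map_mul P.κ.κ m.1 m'.1 }
            continuous_isoM := ⟨P.κ.continuous_κ.comp continuous_subtype_val,
              P.κ.continuous_κ_symm.subtype_mk fun a => by simp [ModelAutHolPair.arithData]⟩
            kummer_compat := fun _ => rfl }, rfl, rfl, fun _ => rfl⟩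

/-- The natural functors `𝒞^hol_TF → 𝒞^hol_T'` keep the structure-orbispace and its field `𝒜_𝕏`, hence
the `LinHol` pair: the first arrow of the 1-factorisation forgets nothing that `κ_LH` needs.
[cite: MochizukiAbsTopIII2015, Proposition 4.2 (ii) pp.105–106] -/
theorem ModelAutHolPair.linHolPair_ofType {T : ArchPairType} (P : ModelAutHolPair.{u} T)
    (T' : ArchPairType) (h : T'.IsAlgebraic) :
    linHolPair (P.ofType T' h).X (P.ofType T' h).L (P.ofType T' h).A = linHolPair P.X P.L P.A := rfl

end

end Literature.AnabelianGeometry.AbsoluteAnabelian
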